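import Literature.AnabelianGeometry.AbsoluteAnabelian.MLFReciprocityCharacterizedProofs
import HarnessLib

/-!
# The reciprocity map of an ARBITRARY finite subextension, characterised, with its image

Sequel of `MLFReciprocityEquivariantProofs.lean` / `MLFReciprocityCharacterizedProofs.lean`
(abc-iut-L6-t11 gen 3, abc-iut-L4-t11 gen 2), which package Serre's `θ_E` read in the Weil datum of
`F` and transported along `Gal(F̄/E₀) ≅ Γ_E` as `Art : E₀ˣ → Gal(F̄/E₀)^ab` for `E/F` finite GALOIS.
Here the SAME construction for `E/F` finite separable, NOT necessarily normal ([AbsAnab] §1.2 p. 9: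
"by local class field theory [...], we have a natural isomorphism `(K_i^×)^∧ ⥲ G^ab_{K_i}`" is used
on p. 11 for ALL open subgroups of `G_{K_i}`, i.e. all finite subextensions, in
`μ_{ℚ/ℤ}(G_K) = lim_{→ H open} (H^ab)_tors`):

* `exists_reciprocity_characterized_embField_general`: `Art : E₀ˣ → Gal(F̄/E₀)^ab`, injective, every
  torsion class in its range, CHARACTERISED by the finite abelian shadows of `θ_E`
  (`Art u = [h] ↔ h|_{L'} = (ι⁻¹u, L'/E)` for all finite abelian `L' ⊆ Ē`), and on Weil
  representatives by Neukirch's reciprocity map of the datum, with its IMAGE: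
  `[h] ∈ range Art ↔ h ∈ W_E · [Γ_E, Γ_E]⁻` (Serre XIV §6 Remark 2: the image of `θ_E` is the image of
  the Weil group) — the clause abc-iut-L6-d1 consumes for the bi-anabelian `k̄^×` sentence.

The `Γ_F`-equivariance clause of the normal case is replaced, for arbitrary `E`, by the two-field
statement `LocalWeilDatum.reciprocity_conj_of_characterized` (`LocalReciprocityCrossConjEquivariance`),
which applies to these maps through the characterisation clause.  Proof-only, no definitions;
classical LCFT (Serre XIII–XIV, Neukirch IV–V).  HONEST FRAMING: no bearing on [IUTchIII] Cor. 3.12.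
-/

noncomputable section

open Field IsNonarchimedeanLocalField ValuativeRel
open scoped Pointwise

namespace Literature.AnabelianGeometry.AbsoluteAnabelian

open Literature.NumberTheory.GaloisRepresentations
open Literature.NumberTheory.GaloisRepresentations.LocalWeilDatum
open AbstractCFT AbstractCFT.WeilDatum

section Package

variable (F E : Type*) [Field F] [ValuativeRel F] [TopologicalSpace F] [IsNonarchimedeanLocalField F]
  [Field E] [Algebra F E] [FiniteDimensional F E] [Algebra.IsSeparable F E]
  [ValuativeRel E] [TopologicalSpace E] [IsNonarchimedeanLocalField E] [ValuativeExtension F E]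

/-- For a normal subgroup `N` and any subgroup `W`: `[σ] ∈ [W]` in `G/N` iff `σ ∈ W ⊔ N`. [folklore] -/
private theorem mk_mem_map_mk'_iff {G : Type*} [Group G] (N W : Subgroup G) [N.Normal] (σ : G) :
    (QuotientGroup.mk' N σ ∈ W.map (QuotientGroup.mk' N)) ↔ σ ∈ W ⊔ N := by
  constructor
  · rintro ⟨w, hw, hwσ⟩
    rw [QuotientGroup.mk'_apply, QuotientGroup.mk'_apply, QuotientGroup.eq] at hwσ
    have : σ = w * (w⁻¹ * σ) := by group
    rw [this]
    exact Subgroup.mul_mem _ (Subgroup.mem_sup_left hw) (Subgroup.mem_sup_right hwσ)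
  · intro hσ
    rw [← SetLike.mem_coe, Subgroup.mul_normal] at hσ
    obtain ⟨w, hw, n, hn, rfl⟩ := hσ
    refine ⟨w, hw, ?_⟩
    rw [QuotientGroup.mk'_apply, QuotientGroup.mk'_apply, QuotientGroup.eq]
    simpa using hn

/-- **The reciprocity map of a finite separable subextension `E₀ = ι⁻¹(E) ⊆ F̄`, characterised, with
its image** ([AbsAnab] §1.2 p. 9: "by local class field theory [...], we have a natural isomorphism
`(K_i^×)^∧ ⥲ G^ab_{K_i}`", for every finite subextension; Serre XIV §6 Thm 1 + Remark 2; Neukirch IV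
(6.3), V (1.3)): there is a homomorphism `Art : E₀ˣ → Gal(F̄/E₀)^ab` (Serre's `θ_E` read inside the
Weil datum of `F`, `recSystemE`, transported along `Gal(F̄/E₀) ≅ Γ_E`) which is injective, whose range
contains every torsion class (`θ_E(U_E) = [I_E] ⊇` torsion, as `Γ_E/I_E ≅ Ẑ` is torsion-free and
`[Γ_E,Γ_E]⁻ ≤ I_E`), CHARACTERISED by the finite abelian shadows of `θ_E` (`Art u = [h]` iff `h`'s
lift to `Γ_E` restricts to `(ι⁻¹u, L'/E)` on every finite abelian `L'`), on Weil representatives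
`w ∈ W_F ∩ G_{E₀}` by `Art u = [w] ↔ r_{U_E,V'}(w) = [ι⁻¹ u]` for every finite abelian `L'/E`, and
whose RANGE is the image of `W_E · [Γ_E,Γ_E]⁻` (`[h] ∈ range Art ↔ lift h ∈ W_E ⊔ [Γ_E,Γ_E]⁻`,
`IsLocalReciprocityMap.range_eq`).  No normality of `E/F` is assumed (for `E/F` Galois this is
`exists_reciprocity_characterized_embField` minus its `Γ_F`-equivariance clause, which for general `E`
is the two-field `LocalWeilDatum.reciprocity_conj_of_characterized`).
[cite: MochizukiAbsAnab2004, Prop 1.2.1 (vi) p.10] -/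
theorem exists_reciprocity_characterized_embField_general :
    ∃ Art : (embField F E)ˣ →* TopologicalAbelianization (galFixing F (embField F E)),
      Function.Injective Art ∧
      (∀ t, IsOfFinOrder t → t ∈ Set.range Art) ∧
      (∀ (u : (embField F E)ˣ) (h : galFixing F (embField F E)),
        Art u = QuotientGroup.mk h ↔
          ∀ (L' : IntermediateField E (AlgebraicClosure E)) [FiniteDimensional E L']
              [IsAbelianGalois E L'],
            AlgEquiv.restrictNormalHom L' (absoluteGaloisGroup.toAlgEquiv E (liftGal F E h.2)) =
              recSystemE (isClassFieldTheory_localWeilDatum F) L'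
                (Units.map ((equivEmbField F E).symm : embField F E →* E) u)) ∧
      (∀ (u : (embField F E)ˣ) (w : fieldSubgroup F (embField F E)),
        Art u = QuotientGroup.mk (toGalFixing F (embField F E) w) ↔
          ∀ (L' : IntermediateField E (AlgebraicClosure E)) [FiniteDimensional E L']
              [IsAbelianGalois E L'],
            (localWeilDatum F).recMap (fieldSubgroup F (embField F E))
                (fieldSubgroup F (embFieldOf F E L')) w =
              QuotientGroup.mk (unitE F E (Units.map ((equivEmbField F E).symm : embField F E →* E) u))) ∧
      ∀ h : galFixing F (embField F E),
        (∃ u : (embField F E)ˣ, Art u = QuotientGroup.mk h) ↔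
          (liftGal F E h.2 : absoluteGaloisGroup E) ∈
            weilSubgroup E ⊔ (commutator (absoluteGaloisGroup E)).topologicalClosure := by
  classical
  set hcf := isClassFieldTheory_localWeilDatum F
  set hω := isReciprocitySystemE (F := F) (E := E) hcf
  have hθ : IsLocalReciprocityMap E hω.theta :=
    hω.isLocalReciprocityMap_theta (universalNormSubgroup_eq_bot E) (isClosed_of_isNormSubgroup_holds E)
  obtain ⟨Φ, hΦ⟩ := exists_continuousMulEquiv_galFixing_embField F E
  obtain ⟨ê, hê⟩ := exists_mulEquiv_topologicalAbelianization Φ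
  let eE : E ≃ₐ[F] embField F E := equivEmbField F E
  let Art : (embField F E)ˣ →* TopologicalAbelianization (galFixing F (embField F E)) :=
    ê.symm.toMonoidHom.comp (hω.theta.comp (Units.map (eE.symm : embField F E →* E)))
  have hArt : ∀ u, Art u = ê.symm (hω.theta (Units.map (eE.symm : embField F E →* E) u)) := fun _ => rfl
  -- `Art u = [h] ↔ θ (ι u) = [liftGal h]`
  have hArt_eq : ∀ (u : (embField F E)ˣ) (h : galFixing F (embField F E)),
      Art u = QuotientGroup.mk h ↔
        absGaloisAbProj E (liftGal F E h.2) = hω.theta (Units.map (eE.symm : embField F E →* E) u) := by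
    intro u h
    rw [hArt, MulEquiv.symm_apply_eq, hê, hΦ, eq_comm]
    exact Iff.rfl
  refine ⟨Art, ?_, ?_, ?_, ?_, ?_⟩
  · -- injective
    intro u v huv
    rw [hArt, hArt] at huv
    have h1 := hθ.injective (ê.symm.injective huv)
    have h2 : (Units.map (eE.symm : embField F E →* E)) u = (Units.map (eE.symm : embField F E →* E)) v := h1
    exact (Units.map_injective (f := (eE.symm : embField F E →* E)) eE.symm.injective) h2
  · -- torsion elements are in the range: they come from `[I_E] = θ(U_E)`
    intro t ht
    obtain ⟨n, hn, htn⟩ := isOfFinOrder_iff_pow_eq_one.mp ht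
    have hCI : (commutator (absoluteGaloisGroup E)).topologicalClosure ≤ absInertia E :=
      WeilGroup.topologicalClosure_commutator_absGalois_le_absInertia
        (WeilGroup.denseRange_toAbsGalois_holds E)
    obtain ⟨σ, hσ⟩ := QuotientGroup.mk_surjective (ê t)
    have hσn : σ ^ n ∈ absInertia E := by
      apply hCI
      rw [← QuotientGroup.eq_one_iff, QuotientGroup.mk_pow, hσ, ← map_pow, htn, map_one]
    have hσI : σ ∈ absInertia E := mem_absInertia_of_pow_mem hn hσn
    have hmem : (QuotientGroup.mk σ : absoluteGaloisGroupAbelianization E) ∈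
        ((absInertia E).map (absGaloisAbProj E)) := ⟨σ, hσI, rfl⟩
    rw [← hθ.map_unitGroup] at hmem
    obtain ⟨v, -, hv⟩ := hmem
    refine ⟨Units.map (eE : E →* embField F E) v, ?_⟩
    rw [hArt, MulEquiv.symm_apply_eq, ← hσ, ← hv]
    congr 1
    ext
    simp [eE]
  · -- characterisation by the finite abelian shadows of `θ_E`
    intro u h
    rw [hArt_eq, hω.absGaloisAbProj_eq_theta_iff, IsReciprocitySystem.mem_reps_iff]
  · -- characterisation on Weil representatives through Neukirch's reciprocity map
    intro u w
    rw [hArt_eq, hω.absGaloisAbProj_eq_theta_iff, IsReciprocitySystem.mem_reps_iff]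
    have h1 : liftGal F E (toGalFixing F (embField F E) w).2 =
        liftGal F E ((toAbsGalois_mem_galFixing_iff (F := F)).mpr w.2) := rfl
    refine ⟨fun hR L' _ _ => ?_, fun hW L' _ _ => ?_⟩
    · have := hR L'
      rw [h1, ← weilRestrictE_apply] at this
      exact (recSystemE_eq_weilRestrictE_iff hcf L' _ w).mp this.symm
    · rw [h1, ← weilRestrictE_apply]
      exact ((recSystemE_eq_weilRestrictE_iff hcf L' _ w).mpr (hW L')).symm
  · -- the range: `[W_E]` (Serre XIV §6 Remark 2), i.e. `W_E · [Γ_E,Γ_E]⁻` upstairs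
    intro h
    have key : (∃ u : (embField F E)ˣ, Art u = QuotientGroup.mk h) ↔
        absGaloisAbProj E (liftGal F E h.2) ∈ hω.theta.range := by
      constructor
      · rintro ⟨u, hu⟩
        exact ⟨_, ((hArt_eq u h).mp hu).symm⟩
      · rintro ⟨x, hx⟩
        refine ⟨Units.map (eE : E →* embField F E) x, (hArt_eq _ h).mpr ?_⟩
        rw [← hx]
        congr 1
        ext
        simp [eE]
    rw [key, hθ.range_eq]
    exact mk_mem_map_mk'_iff _ _ _

end Package

end Literature.AnabelianGeometry.AbsoluteAnabelian
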